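/-
Copyright (c) 2026. All rights reserved.
Released under Apache 2.0 license as described in the file LICENSE.
Authors: abc-iut cell, seat abc-iut-L4-t15 (gen 6).
-/
import Mathlib.Algebra.Group.Subgroup.Basic
import Mathlib.GroupTheory.Coset.Basic
import Mathlib.Tactic.Group

/-!
# Normal closure in `G` versus normal closure in a subgroup, via a transversal

Let `U ≤ G` and let `R ⊆ G` be such that `G = U R` (every `g` is `u * r` with `u ∈ U`, `r ∈ R`; e.g. a
transversal of a normal subgroup of finite index).  If all `R`-conjugates of a set `X` lie in `U`, then
the normal closure of `X` in `G` is contained in (the image of) the normal closure in `↥U` of the set of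
`R`-conjugates of `X` (`normalClosure_le_map_normalClosure_conj`): a `G`-conjugate `g x g⁻¹ = u (r x r⁻¹) u⁻¹`
is a `U`-conjugate of an `R`-conjugate.

Mathlib-only; no definitions, no instances (cell abc-iut, GAP-LEDGER G-L3d2g2-1: slot bookkeeping of the
inheritance step for `p`-by-metacyclic profinite groups). [cite: RibesZalesskii2010, §2.1]
-/

namespace Literature.GroupTheory

variable {G : Type*} [Group G]

/-- **`G`-normal closure inside a `U`-normal closure of `R`-conjugates.**  If `G = U R` and
`r x r⁻¹ ∈ U` for `r ∈ R`, `x ∈ X`, then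
`normalClosure X ≤ (normalClosure {y : U | ∃ r ∈ R, ∃ x ∈ X, ↑y = r x r⁻¹}).map U.subtype`.
[cite: RibesZalesskii2010, §2.1] -/
theorem normalClosure_le_map_normalClosure_conj (U : Subgroup G) (R X : Set G)
    (hUR : ∀ g : G, ∃ u ∈ U, ∃ r ∈ R, g = u * r)
    (hX : ∀ r ∈ R, ∀ x ∈ X, r * x * r⁻¹ ∈ U) :
    Subgroup.normalClosure X ≤
      (Subgroup.normalClosure {y : U | ∃ r ∈ R, ∃ x ∈ X, (y : G) = r * x * r⁻¹}).map U.subtype := by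
  set N : Subgroup U := Subgroup.normalClosure {y : U | ∃ r ∈ R, ∃ x ∈ X, (y : G) = r * x * r⁻¹} with hN
  haveI hNn : N.Normal := Subgroup.normalClosure_normal
  change Subgroup.closure (Group.conjugatesOfSet X) ≤ N.map U.subtype
  rw [Subgroup.closure_le]
  intro y hy
  obtain ⟨x, hx, hxy⟩ := Group.mem_conjugatesOfSet_iff.mp hy
  obtain ⟨g, rfl⟩ := isConj_iff.mp hxy
  obtain ⟨u, hu, r, hr, rfl⟩ := hUR g
  have hrx : r * x * r⁻¹ ∈ U := hX r hr x hx
  have hmem : (⟨r * x * r⁻¹, hrx⟩ : U) ∈ N := Subgroup.subset_normalClosure ⟨r, hr, x, hx, rfl⟩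
  have hconj : (⟨u, hu⟩ : U) * ⟨r * x * r⁻¹, hrx⟩ * (⟨u, hu⟩ : U)⁻¹ ∈ N := hNn.conj_mem _ hmem _
  refine ⟨_, hconj, ?_⟩
  simp only [Subgroup.coe_subtype, Subgroup.coe_mul, Subgroup.coe_inv]
  group

/-- **`G = U · R` for the `out`-transversal of a normal subgroup.**  Every `g` is `u * r` with `u ∈ U` and
`r` in the range of `Quotient.out : G ⧸ U → G`. [cite: RibesZalesskii2010, §2.1] -/
theorem exists_mem_mul_out_eq (U : Subgroup G) [hU : U.Normal] (g : G) :
    ∃ u ∈ U, ∃ r ∈ Set.range (fun q : G ⧸ U => q.out), g = u * r := by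
  obtain ⟨h, hh⟩ := QuotientGroup.mk_out_eq_mul U g
  refine ⟨(QuotientGroup.mk g : G ⧸ U).out * (h : G)⁻¹ * ((QuotientGroup.mk g : G ⧸ U).out)⁻¹,
    hU.conj_mem _ (U.inv_mem h.2) _, (QuotientGroup.mk g : G ⧸ U).out, ⟨_, rfl⟩, ?_⟩
  rw [hh]
  group

end Literature.GroupTheory
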